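import Summits.PneNP.PneNP.Theses.ConvexRankGates
import Summits.PneNP.PneNP.Theorems.ConvexRankGatesConvexGateBlindCollapseMain

/-!
# PneNP / ConvexRankGates — the crux `ConvexGateBlind` is a single-gate statement

Helper file for the crux `ConvexGateBlind` (item `stmt-PneNP-10680`) of route `ConvexRankGates`
(`--supports`; closes nothing by itself): by the collapse theorem
`exists_oneConvGate_of_isOver`, the crux — no polynomial-size `{∧₂, ∨₂} ∪ CONV_{m^c}` circuit
computes `CLIQUE(m, ⌈m^δ⌉₊)` — is EQUIVALENT to the statement that no single CONV gate of
polynomial size parameter wired to the edge variables computes `CLIQUE(m, ⌈m^δ⌉₊)`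
(`convexGateBlind_iff_oneGate`). This makes precise the planner's remark that the crux is a
psd-lift lower bound for one monotone SDP-feasibility gate (LP case: the open single weak-MLP-gate
problem, Oliveira–Pudlák 2019, p. 3; Hrubeš 2020, Open Problem 3).
-/

namespace Summit.PneNP.PneNP.Theorems

open Literature.Computability.Complexity Matrix Finset

/-! ### The crux `ConvexGateBlind` is a single-gate statement -/

/-- `#E(K_m) ≤ m²`. [folklore] -/
theorem card_edgeSet_top_le (m : ℕ) : Fintype.card ((⊤ : SimpleGraph (Fin m)).edgeSet) ≤ m ^ 2 := by
  calc Fintype.card ((⊤ : SimpleGraph (Fin m)).edgeSet)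
      ≤ Fintype.card (Sym2 (Fin m)) := Fintype.card_le_of_injective Subtype.val Subtype.val_injective
    _ ≤ Fintype.card (Fin m × Fin m) :=
        Fintype.card_le_of_surjective (Sym2.mk (α := Fin m)).uncurry Sym2.mk_surjective
    _ = m ^ 2 := by simp [sq]

/-- Polynomial bookkeeping for the collapse inside the crux: with `s = m^c`, `t ≤ m^c` gates and
`n ≤ m²` inputs, `4 (s + 3) (t + n + 1)² ≤ m^(3c+12)` for `m ≥ 2`. [folklore] -/
theorem collapse_bound_le_pow {m c t n : ℕ} (hm : 2 ≤ m) (ht : t ≤ m ^ c) (hn : n ≤ m ^ 2) :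
    4 * (m ^ c + 3) * (t + n + 1) ^ 2 ≤ m ^ (3 * c + 12) := by
  have h1 : 1 ≤ m := by omega
  have hc1 : 1 ≤ m ^ c := Nat.one_le_pow _ _ h1
  have hA : m ^ c + 3 ≤ 4 * m ^ c := by omega
  have hB : t + n + 1 ≤ 3 * m ^ (c + 2) := by
    have e1 : m ^ c ≤ m ^ (c + 2) := Nat.pow_le_pow_right h1 (by omega)
    have e2 : m ^ 2 ≤ m ^ (c + 2) := Nat.pow_le_pow_right h1 (by omega)
    have e3 : 1 ≤ m ^ (c + 2) := Nat.one_le_pow _ _ h1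
    omega
  have h256 : 144 ≤ m ^ 8 := by
    calc 144 ≤ 2 ^ 8 := by norm_num
      _ ≤ m ^ 8 := Nat.pow_le_pow_left hm 8
  calc 4 * (m ^ c + 3) * (t + n + 1) ^ 2
      ≤ 4 * (4 * m ^ c) * (3 * m ^ (c + 2)) ^ 2 :=
        Nat.mul_le_mul (Nat.mul_le_mul_left 4 hA) (Nat.pow_le_pow_left hB 2)
    _ = 144 * (m ^ c * (m ^ (c + 2)) ^ 2) := by ring
    _ ≤ m ^ 8 * (m ^ c * (m ^ (c + 2)) ^ 2) := Nat.mul_le_mul_right _ h256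
    _ = m ^ (3 * c + 12) := by ring

/-- **`ConvexGateBlind` is equivalent to its single-gate form.** Crux #2 of route
ConvexRankGates — no polynomial-size `{∧₂, ∨₂} ∪ CONV_{m^c}` circuit computes
`CLIQUE(m, ⌈m^δ⌉₊)` — holds iff no single CONV gate of polynomial size parameter, wired to the edge
variables, computes `CLIQUE(m, ⌈m^δ⌉₊)` (same `δ`; the exponent changes from `c` to `3c + 12` by
`exists_oneConvGate_of_isOver`). So the crux IS a psd-lift / monotone-SDP-representation lower
bound for one gate, the SDP analogue of the open single-weak-MLP-gate problem
(Oliveira–Pudlák 2019, p. 3). [folklore] -/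
theorem convexGateBlind_iff_oneGate :
    open scoped Classical in
    Summit.PneNP.PneNP.Theses.ConvexRankGates.ConvexGateBlind ↔
      ∃ δ : ℝ, 0 < δ ∧ δ < 1 / 2 ∧ ∀ c : ℕ, ∀ᶠ m : ℕ in Filter.atTop, ∀ g : GateFn,
        IsConvGate (m ^ c) g → ∀ w : Fin g.1 → (⊤ : SimpleGraph (Fin m)).edgeSet,
          ¬ ∀ x : (⊤ : SimpleGraph (Fin m)).edgeSet → Bool, g.2 (fun a => x (w a)) =
            decide (¬ (SimpleGraph.fromEdgeSet {e : Sym2 (Fin m) |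
              ∃ h : e ∈ (⊤ : SimpleGraph (Fin m)).edgeSet, x ⟨e, h⟩ = true}).CliqueFree
                ⌈(m : ℝ) ^ δ⌉₊) := by
  constructor
  · rintro ⟨δ, hδ0, hδ1, h⟩
    refine ⟨δ, hδ0, hδ1, fun c => ?_⟩
    filter_upwards [h c, Filter.eventually_ge_atTop 1] with m hm h1 g hg w hcomp
    obtain ⟨C₁, hC₁, hs₁, he₁⟩ := (CktSize.gate (B := {g | IsConvGate (m ^ c) g}) g hg w).toCircuit
    refine hm C₁ (hC₁.mono fun g' hg' => Or.inr hg') (hs₁.trans (Nat.one_le_pow _ _ h1)) fun x => ?_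
    rw [he₁ x]
    exact hcomp x
  · rintro ⟨δ, hδ0, hδ1, h⟩
    refine ⟨δ, hδ0, hδ1, fun c => ?_⟩
    filter_upwards [h (3 * c + 12), Filter.eventually_ge_atTop 2] with m hm h2 C hC hsize hcomp
    obtain ⟨g, hg, w, hw⟩ := exists_oneConvGate_of_isOver (s := m ^ c) C
      (fun g' hg' => by
        rcases hC g' hg' with h' | h'
        · exact Or.inl h'
        · exact Or.inr h')
    have hg' : IsConvGate (m ^ (3 * c + 12)) g :=
      hg.mono (collapse_bound_le_pow h2 hsize (card_edgeSet_top_le m))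
    exact hm g hg' w fun x => (hw x).trans (hcomp x)

end Summit.PneNP.PneNP.Theorems
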